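import Mathlib.Analysis.InnerProductSpace.PiL2
import Mathlib.Analysis.SpecialFunctions.Pow.Real
import Mathlib.MeasureTheory.Integral.Average
import Mathlib.MeasureTheory.Integral.IntervalIntegral.Basic
import Literature.Analysis.FluidPDE.SelfSimilar
import Literature.Analysis.FluidPDE.VectorCalculus
import HarnessLib

/-!
# Conditional Liouville theorems for steady `D`-solutions under growth of an antiderivative
(Coiculescu–Yang 2025, "capsule method")

Topic `Literature/Analysis/FluidPDE`; ONE named fact (result in print, `def … : Prop`, D-0014),
typed for the blow-up scenario census of `NavierStokesRegularity` (cell `pub/ns-census`,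
SCENARIO-CENSUS row **S1i**, PRINT-STATUS §17.7 (4) / §18.4), as a sibling of
`SteadyNSLiouville.lean` (`SteadyDSolutionLiouvilleProblem`, Galdi's open problem = row S1, and its
printed partial answers) and `SteadyLiouvilleCriteria.lean`.

**Source.** M. P. Coiculescu, J. Yang, *Conditional Liouville theorems for the Navier–Stokes
equations*, Calc. Var. Partial Differential Equations **65** (2025), no. 1 = arXiv:2506.14533
[CoiculescuYang2025] (held text = the arXiv version; chunk/line locators refer to it; the journal
numbering of the two theorems is assumed identical — they are the two theorems of §1):
* §1 (chunk p0003 L8–22): the stationary system `−Δu + u·∇u + ∇p = 0`, `div u = 0` on `ℝ³`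
  (viscosity `1`, no force), `u`, `p` smooth, the "natural vanishing condition at infinity"
  `lim_{|x|→∞} u(x) = 0`, and finite Dirichlet energy `∫_{ℝ³} |∇u|² dx < ∞` ("`D`-solutions");
  "the question whether nontrivial `D`-solutions exist is called the Liouville problem".
* **Theorem 1.1** (p0003 L47 – p0004 L4): "Suppose `u ∈ C^∞(ℝ³)` is a `D`-solution of the
  stationary Navier–Stokes equations. Let `s ≥ 1` be arbitrary. If `u = curl ψ` and satisfies
  `(⨍_{B_R(x₀)} |ψ − (ψ)_{B_R(x₀)}|^s dx)^{1/s} ≤ C R^α` for all `R > 1`, all `x₀ ∈ ℝ³`, for some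
  constants `C > 0` and `0 < α < 1`, then `u ∈ L^{p,∞}` for any `p > 4/(1 − α)`. Moreover, if
  `α < 1/9`, then `u ≡ 0`."
* **Theorem 1.2** (p0004 L6–12): "Suppose `u ∈ C^∞(ℝ³)` is a `D`-solution of the stationary
  Navier–Stokes equations. If `u` satisfies `∫_{x₀}^{x} u · dℓ ≤ C|x − x₀|^β` for all
  `x₀, x ∈ ℝ³`, for some constants `C > 0` and `0 < β < 1`, then `u ∈ L^{p,∞}` for any
  `p > (4 − 34β/29)/(1 − β)`. Moreover, if `β < 29/193`, then `u ≡ 0`." Here "`∫_{x₀}^{x}` means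
  integration on a straight line segment connecting `x₀` and `x`" (p0004 L16–17).
  The authors note (p0004 L14–15) that Thm 1.1 improves Seregin's criterion (`s > 3`,
  `α(s) = (s−3)/(6(s−1))`) and Chae–Wolf's (`u = div T`), "our threshold `α = 1/9` is uniform
  across the exponents".

## Rendering notes (faithfulness)
* Hypothesis block = the census block of row S1, letter for letter as in
  `SteadyDSolutionLiouvilleProblem` (`SteadyNSLiouville.lean`): `IsLerayProfile 1 0 u p` (the steady
  system with `ν = 1`, `a = 0`), `u`, `p` of class `C^∞`, finite Dirichlet integral
  `∫⁻ |∇u|²_F < ⊤` (`frobeniusNormSq (fderiv ℝ u x)`), `u → 0` along `cocompact`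
  (= the printed uniform limit `lim_{|x|→∞} u(x) = 0`).
* `u = curl ψ`: the source only says "if `u = curl ψ`" (in §4.3, `ψ ∈ L¹_loc`); here `ψ` is taken
  of class `C¹` with `u x = curl ψ x` pointwise (`VectorCalculus.lean`, the tree's
  curl on `ℝ³`) — a SPECIAL CASE of the printed hypothesis (stronger assumption on `ψ`), hence
  implied by the printed theorem. -- TODO(general form): distributional `ψ ∈ L¹_loc`.
* Mean oscillation: `(ψ)_{B_R(x₀)} = ⨍_{B_R(x₀)} ψ` is the Bochner average of the vector field over
  the (open) ball, `|·|` the Euclidean norm, the outer `⨍` the average of the real function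
  `|ψ − (ψ)_B|^s` (`Real.rpow`), exponent `1/s`; `s ≥ 1` real, as printed ("`L^s` control on the
  mean oscillation for `1 ≤ s ≤ 3` as well").
* Line integral over the straight segment: `∫_{x₀}^{x} u·dℓ = ∫₀¹ ⟪u(x₀ + τ(x − x₀)), x − x₀⟫ dτ`
  (interval integral). The printed hypothesis is the ONE-SIDED inequality for all ordered pairs
  `(x₀, x)` (swapping the pair reverses the sign, so it is a two-sided Hölder bound); kept as printed.
* Only the two LIOUVILLE conclusions ("Moreover, … `u ≡ 0`") are vendored, packed into ONE `Prop`
  (a conjunction), so the file adds exactly one named fact; the weak-`L^p` conclusions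
  (`u ∈ L^{p,∞}`, `p > 4/(1−α)` resp. `p > (4 − 34β/29)/(1−β)`) are NOT vendored.
  -- TODO(general form): the `L^{p,∞}` conclusions of Thms 1.1–1.2 and the capsule criterion
  -- (their §4 general conditional theorem).

## Deliberately statement-only
Nothing is proved here (Literature = cited statements; D-0014/D-0026: one fact, no helpers, no
`_holds`). Not a statement about NS blow-up; the census row S1i it backs is a printed PARTIAL
answer to Galdi's Liouville problem (row S1, OPEN).
-/

noncomputable section

open MeasureTheory Filter Set
open _root_.Topology

namespace Literature.Analysis.FluidPDE

/-- **Coiculescu–Yang 2025, Theorems 1.1 and 1.2 (Liouville parts)** — conditional triviality of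
smooth steady `D`-solutions of `−Δu + (u·∇)u + ∇p = 0`, `div u = 0` on `ℝ³` with `u → 0` at
infinity and `∫|∇u|² < ∞`, under a growth condition on an ANTIDERIVATIVE of `u`:
(1.1) if `u = curl ψ` (`ψ ∈ C¹` here) and, for some `s ≥ 1`, `C > 0`, `0 < α < 1/9`, the mean
oscillation of `ψ` obeys `(⨍_{B_R(x₀)} |ψ − (ψ)_{B_R(x₀)}|^s)^{1/s} ≤ C R^α` for all `R > 1` and
all `x₀`, then `u ≡ 0` ("Moreover, if `α < 1/9`, then `u ≡ 0`"); (1.2) if, for some `C > 0` and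
`0 < β < 29/193`, the straight-segment line integrals obey `∫_{x₀}^{x} u·dℓ ≤ C|x − x₀|^β` for
all `x₀, x`, then `u ≡ 0` ("Moreover, if `β < 29/193`, then `u ≡ 0`"). The printed weak-`L^p`
conclusions for `α < 1` resp. `β < 1` are not vendored (module docstring). Not proved in the tree.
[cite: CoiculescuYang2025, Thm 1.1 and Thm 1.2 (Liouville parts; arXiv:2506.14533 §1, p0003 L47–p0004 L12)] -/
def CoiculescuYang2025_capsule_liouville : Prop :=
  (∀ (u : EuclideanSpace ℝ (Fin 3) → EuclideanSpace ℝ (Fin 3)) (p : EuclideanSpace ℝ (Fin 3) → ℝ)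
      (ψ : EuclideanSpace ℝ (Fin 3) → EuclideanSpace ℝ (Fin 3)) (s α C : ℝ),
    IsLerayProfile 1 0 u p → ContDiff ℝ (⊤ : ℕ∞) u → ContDiff ℝ (⊤ : ℕ∞) p →
    (∫⁻ x, ENNReal.ofReal (frobeniusNormSq (fderiv ℝ u x))) < ⊤ →
    Tendsto u (cocompact (EuclideanSpace ℝ (Fin 3))) (𝓝 0) →
    ContDiff ℝ 1 ψ → (∀ x, u x = curl ψ x) →
    1 ≤ s → 0 < C → 0 < α → α < 1 / 9 →
    (∀ (x₀ : EuclideanSpace ℝ (Fin 3)) (R : ℝ), 1 < R →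
      (⨍ x in Metric.ball x₀ R, ‖ψ x - ⨍ y in Metric.ball x₀ R, ψ y‖ ^ s) ^ (1 / s) ≤ C * R ^ α) →
    u = 0) ∧
  (∀ (u : EuclideanSpace ℝ (Fin 3) → EuclideanSpace ℝ (Fin 3)) (p : EuclideanSpace ℝ (Fin 3) → ℝ)
      (β C : ℝ),
    IsLerayProfile 1 0 u p → ContDiff ℝ (⊤ : ℕ∞) u → ContDiff ℝ (⊤ : ℕ∞) p →
    (∫⁻ x, ENNReal.ofReal (frobeniusNormSq (fderiv ℝ u x))) < ⊤ →
    Tendsto u (cocompact (EuclideanSpace ℝ (Fin 3))) (𝓝 0) →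
    0 < C → 0 < β → β < 29 / 193 →
    (∀ x₀ x : EuclideanSpace ℝ (Fin 3),
      ∫ τ in (0 : ℝ)..1, inner ℝ (u (x₀ + τ • (x - x₀))) (x - x₀) ≤ C * ‖x - x₀‖ ^ β) →
    u = 0)

end Literature.Analysis.FluidPDE

end
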